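import Mathlib

/-!
# Base change of exterior powers: `S ⊗[R] ⋀[R]^n M ≃ₗ[S] ⋀[S]^n (S ⊗[R] M)`

Blind cell `pub-hodge-repro2`, seat p7 (gen 10), A1 annex (route/T4-A1-p7.md, Lemma A1.3's first
sentence; route/LEAN-ANNEX-p7.md §4).  Lemma A1.3 constructs Deligne's `∧^n_F V ⊂ ∧^n_ℚ V` «by
descent from the split case»: over a splitting field `L` one works in `⋀^n_L (L ⊗ V)` (where the
eigenlines `V_σ` live, `A1EigenlinePermutation`), while Galois descent (`A1GaloisDescentSubspace`)
lives in `L ⊗_ℚ ⋀^n_ℚ V`.  The bridge between the two is the base-change isomorphism of exterior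
powers, which Mathlib does not have; this file supplies it for free modules, together with the
Galois compatibility needed to carry the descent across.

* `toBaseChange : ⋀[R]^n M →ₗ[R] ⋀[S]^n (S ⊗[R] M)`, `m₁ ∧ … ∧ mₙ ↦ (1 ⊗ m₁) ∧ … ∧ (1 ⊗ mₙ)`;
* `baseChangeMap : S ⊗[R] ⋀[R]^n M →ₗ[S] ⋀[S]^n (S ⊗[R] M)`, its `S`-linear extension;
* `baseChangeMap_basis`: it carries the basis `1 ⊗ (b_{s₁} ∧ … ∧ b_{sₙ})` to the basis
  `(1 ⊗ b_{s₁}) ∧ … ∧ (1 ⊗ b_{sₙ})`, hence `bijective_baseChangeMap` when `M` is free and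
  `baseChangeEquiv : S ⊗[R] ⋀[R]^n M ≃ₗ[S] ⋀[S]^n (S ⊗[R] M)`;
* Galois compatibility: for `τ : S ≃ₐ[R] S` the transported action
  `actExt τ := baseChangeEquiv ∘ (τ ⊗ id) ∘ baseChangeEquiv⁻¹` on `⋀[S]^n (S ⊗[R] M)` is the
  expected `τ`-semilinear map «`⋀^n (τ ⊗ id)`»: `actExt τ (w₁ ∧ … ∧ wₙ) = (τ⊗id) w₁ ∧ … ∧ (τ⊗id) wₙ`
  for ALL `w_i ∈ S ⊗[R] M` (`actExt_ιMulti`), and `actExt τ (s • x) = τ s • actExt τ x`.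

Design: the isomorphism is DEFINED through the universal property (so its values on all pure
tensors are known, `baseChangeMap_tmul_ιMulti`) and only PROVED bijective through a basis.  The
scalar-tower instance `IsScalarTower R S (ExteriorAlgebra S W)` is Mathlib's own
`RingCon.instIsScalarTowerQuotient` (the `CliffordAlgebra` instance is not found by instance search
for the exterior algebra of an `S`-module that is also an `R`-module); it is a `Prop`, so no
diamond can arise.

README §8(d): uses an L-value-free non-vanishing device: NO.
-/

namespace Summit.Ventures.HodgeRepro2.A1ExteriorBaseChange

open TensorProduct

section Instances

variable (R S W : Type*) [CommRing R] [CommRing S] [Algebra R S]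
  [AddCommGroup W] [Module R W] [Module S W] [IsScalarTower R S W]

/-- The scalar tower `R → S → ExteriorAlgebra S W` for an `S`-module `W` that is compatibly an
`R`-module.  This is Mathlib's `RingCon.instIsScalarTowerQuotient` applied to the exterior algebra
(a `Prop`-valued instance; instance search does not find the `CliffordAlgebra` form of it here). -/
instance instIsScalarTowerExterior : IsScalarTower R S (ExteriorAlgebra S W) :=
  RingCon.instIsScalarTowerQuotient _

end Instances

section Map

variable (R S M : Type*) [CommRing R] [CommRing S] [Algebra R S] [AddCommGroup M] [Module R M]
  (n : ℕ)

/-- The canonical alternating map `W^n → ⋀[S]^n W` of an `S`-module `W`, read as an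
`R`-alternating map (restriction of scalars along `R → S`). -/
noncomputable def ιMultiRestrict (W : Type*) [AddCommGroup W] [Module R W] [Module S W]
    [IsScalarTower R S W] : W [⋀^Fin n]→ₗ[R] ⋀[S]^n W :=
  { (exteriorPower.ιMulti S n).toMultilinearMap.restrictScalars R with
    map_eq_zero_of_eq' := fun v _ _ h hij =>
      (exteriorPower.ιMulti S n).map_eq_zero_of_eq v h hij }

/-- `ιMultiRestrict` is `ιMulti S n` as a function. -/
@[simp] theorem ιMultiRestrict_apply (W : Type*) [AddCommGroup W] [Module R W] [Module S W]
    [IsScalarTower R S W] (w : Fin n → W) :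
    ιMultiRestrict R S n W w = exteriorPower.ιMulti S n w := rfl

/-- The `R`-alternating map `(m₁, …, mₙ) ↦ (1 ⊗ m₁) ∧ … ∧ (1 ⊗ mₙ)` into `⋀[S]^n (S ⊗[R] M)`. -/
noncomputable def ιTensor : M [⋀^Fin n]→ₗ[R] ⋀[S]^n (S ⊗[R] M) :=
  (ιMultiRestrict R S n (S ⊗[R] M)).compLinearMap (TensorProduct.mk R S M 1)

/-- `ιTensor (m_i) = (1 ⊗ m₁) ∧ … ∧ (1 ⊗ mₙ)`. -/
@[simp] theorem ιTensor_apply (m : Fin n → M) :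
    ιTensor R S M n m = exteriorPower.ιMulti S n (fun i => (1 : S) ⊗ₜ[R] m i) := rfl

/-- The `R`-linear map `⋀[R]^n M → ⋀[S]^n (S ⊗[R] M)`, `m₁ ∧ … ∧ mₙ ↦ (1 ⊗ m₁) ∧ … ∧ (1 ⊗ mₙ)`. -/
noncomputable def toBaseChange : ⋀[R]^n M →ₗ[R] ⋀[S]^n (S ⊗[R] M) :=
  exteriorPower.alternatingMapLinearEquiv (ιTensor R S M n)

/-- `toBaseChange (m₁ ∧ … ∧ mₙ) = (1 ⊗ m₁) ∧ … ∧ (1 ⊗ mₙ)`. -/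
@[simp] theorem toBaseChange_ιMulti (m : Fin n → M) :
    toBaseChange R S M n (exteriorPower.ιMulti R n m) =
      exteriorPower.ιMulti S n (fun i => (1 : S) ⊗ₜ[R] m i) := by
  simp [toBaseChange]

/-- The base-change map `S ⊗[R] ⋀[R]^n M →ₗ[S] ⋀[S]^n (S ⊗[R] M)`, the `S`-linear extension of
`toBaseChange`. -/
noncomputable def baseChangeMap : S ⊗[R] ⋀[R]^n M →ₗ[S] ⋀[S]^n (S ⊗[R] M) :=
  LinearMap.liftBaseChange S (toBaseChange R S M n)

/-- `baseChangeMap (s ⊗ x) = s • toBaseChange x`. -/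
@[simp] theorem baseChangeMap_tmul (s : S) (x : ⋀[R]^n M) :
    baseChangeMap R S M n (s ⊗ₜ[R] x) = s • toBaseChange R S M n x :=
  LinearMap.liftBaseChange_tmul _ _ _ _

/-- `baseChangeMap (s ⊗ (m₁ ∧ … ∧ mₙ)) = s • ((1 ⊗ m₁) ∧ … ∧ (1 ⊗ mₙ))`. -/
theorem baseChangeMap_tmul_ιMulti (s : S) (m : Fin n → M) :
    baseChangeMap R S M n (s ⊗ₜ[R] exteriorPower.ιMulti R n m) =
      s • exteriorPower.ιMulti S n (fun i => (1 : S) ⊗ₜ[R] m i) := by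
  simp

end Map

section Basis

variable (R S M : Type*) [CommRing R] [CommRing S] [Algebra R S] [AddCommGroup M] [Module R M]
  (n : ℕ) {I : Type*} [LinearOrder I]

/-- The base-change map carries the basis `1 ⊗ (b_{s₁} ∧ … ∧ b_{sₙ})` of `S ⊗[R] ⋀[R]^n M` to the
basis `(1 ⊗ b_{s₁}) ∧ … ∧ (1 ⊗ b_{sₙ})` of `⋀[S]^n (S ⊗[R] M)`. -/
theorem baseChangeMap_basis (b : Module.Basis I R M) (t : Set.powersetCard I n) :
    baseChangeMap R S M n (Algebra.TensorProduct.basis S (b.exteriorPower n) t) =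
      (Algebra.TensorProduct.basis S b).exteriorPower n t := by
  rw [Algebra.TensorProduct.basis_apply, exteriorPower.basis_apply, exteriorPower.basis_apply,
    exteriorPower.ιMulti_family, exteriorPower.ιMulti_family, baseChangeMap_tmul_ιMulti, one_smul]
  congr 1
  ext i
  simp [Algebra.TensorProduct.basis_apply]

/-- As linear maps, `baseChangeMap` is the basis-to-basis equivalence. -/
theorem baseChangeMap_eq_basisEquiv (b : Module.Basis I R M) :
    (baseChangeMap R S M n : S ⊗[R] ⋀[R]^n M →ₗ[S] ⋀[S]^n (S ⊗[R] M)) =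
      ((Algebra.TensorProduct.basis S (b.exteriorPower n)).equiv
        ((Algebra.TensorProduct.basis S b).exteriorPower n) (Equiv.refl _) :
          S ⊗[R] ⋀[R]^n M →ₗ[S] ⋀[S]^n (S ⊗[R] M)) :=
  Module.Basis.ext (Algebra.TensorProduct.basis S (b.exteriorPower n)) fun t => by
    rw [baseChangeMap_basis, LinearEquiv.coe_coe, Module.Basis.equiv_apply, Equiv.refl_apply]

/-- **Base change of exterior powers is an isomorphism** for a module with a basis. -/
theorem bijective_baseChangeMap (b : Module.Basis I R M) :
    Function.Bijective (baseChangeMap R S M n) := by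
  rw [baseChangeMap_eq_basisEquiv R S M n b]
  exact LinearEquiv.bijective _

/-- The base-change isomorphism `S ⊗[R] ⋀[R]^n M ≃ₗ[S] ⋀[S]^n (S ⊗[R] M)` of a module with a
basis; its underlying map is `baseChangeMap` (so all its values are known on pure tensors). -/
noncomputable def baseChangeEquiv (b : Module.Basis I R M) :
    S ⊗[R] ⋀[R]^n M ≃ₗ[S] ⋀[S]^n (S ⊗[R] M) :=
  LinearEquiv.ofBijective (baseChangeMap R S M n) (bijective_baseChangeMap R S M n b)

/-- `baseChangeEquiv` is `baseChangeMap` as a function. -/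
@[simp] theorem baseChangeEquiv_apply (b : Module.Basis I R M) (x : S ⊗[R] ⋀[R]^n M) :
    baseChangeEquiv R S M n b x = baseChangeMap R S M n x := rfl

/-- `baseChangeEquiv⁻¹ y = x ↔ baseChangeMap x = y`. -/
theorem baseChangeEquiv_symm_apply_eq_iff (b : Module.Basis I R M) (x : S ⊗[R] ⋀[R]^n M)
    (y : ⋀[S]^n (S ⊗[R] M)) :
    (baseChangeEquiv R S M n b).symm y = x ↔ baseChangeMap R S M n x = y := by
  rw [LinearEquiv.symm_apply_eq, baseChangeEquiv_apply]
  exact eq_comm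

/-- The inverse isomorphism on a wedge of pure tensors `1 ⊗ m_i`. -/
theorem baseChangeEquiv_symm_ιMulti (b : Module.Basis I R M) (m : Fin n → M) :
    (baseChangeEquiv R S M n b).symm (exteriorPower.ιMulti S n (fun i => (1 : S) ⊗ₜ[R] m i)) =
      (1 : S) ⊗ₜ[R] exteriorPower.ιMulti R n m := by
  rw [baseChangeEquiv_symm_apply_eq_iff, baseChangeMap_tmul_ιMulti, one_smul]

end Basis

section Free

variable (R S M : Type*) [CommRing R] [CommRing S] [Algebra R S] [AddCommGroup M] [Module R M]
  (n : ℕ)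

/-- Base change of exterior powers is an isomorphism for every free module (a basis index set
carries a well-order, hence a linear order). -/
theorem bijective_baseChangeMap_of_free [Module.Free R M] :
    Function.Bijective (baseChangeMap R S M n) := by
  letI : LinearOrder (Module.Free.ChooseBasisIndex R M) := IsWellOrder.linearOrder WellOrderingRel
  exact bijective_baseChangeMap R S M n (Module.Free.chooseBasis R M)

end Free

section Galois

variable {R S M : Type*} [CommRing R] [CommRing S] [Algebra R S] [AddCommGroup M] [Module R M]
  {n : ℕ} {I : Type*} [LinearOrder I] (b : Module.Basis I R M)

/-- `τ ⊗ id` on `S ⊗[R] N` for `τ : S ≃ₐ[R] S` (the Galois action on the coefficients; the same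
map as `A1GaloisDescentSubspace.act`, here over an arbitrary base ring `R`). -/
noncomputable abbrev coeffAct (N : Type*) [AddCommGroup N] [Module R N] (τ : S ≃ₐ[R] S) :
    S ⊗[R] N →ₗ[R] S ⊗[R] N :=
  LinearMap.rTensor N τ.toLinearMap

/-- `(τ ⊗ id) (s ⊗ x) = τ s ⊗ x`. -/
theorem coeffAct_tmul (N : Type*) [AddCommGroup N] [Module R N] (τ : S ≃ₐ[R] S) (s : S) (x : N) :
    coeffAct N τ (s ⊗ₜ[R] x) = τ s ⊗ₜ[R] x := rfl

/-- `τ ⊗ id` is `τ`-semilinear. -/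
theorem coeffAct_smul (N : Type*) [AddCommGroup N] [Module R N] (τ : S ≃ₐ[R] S) (s : S)
    (x : S ⊗[R] N) : coeffAct N τ (s • x) = τ s • coeffAct N τ x := by
  induction x using TensorProduct.induction_on with
  | zero => simp
  | tmul c v => simp [smul_tmul']
  | add a b ha hb => simp only [smul_add, map_add, ha, hb]

/-- The Galois action on `⋀[S]^n (S ⊗[R] M)` transported from `τ ⊗ id` on `S ⊗[R] ⋀[R]^n M`
through the base-change isomorphism: `actExt τ = baseChangeEquiv ∘ (τ ⊗ id) ∘ baseChangeEquiv⁻¹`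
(an `R`-linear, `τ`-semilinear endomorphism). -/
noncomputable def actExt (τ : S ≃ₐ[R] S) : ⋀[S]^n (S ⊗[R] M) →ₗ[R] ⋀[S]^n (S ⊗[R] M) :=
  ((baseChangeEquiv R S M n b).restrictScalars R : S ⊗[R] ⋀[R]^n M →ₗ[R] ⋀[S]^n (S ⊗[R] M)) ∘ₗ
    coeffAct (⋀[R]^n M) τ ∘ₗ
      ((baseChangeEquiv R S M n b).symm.restrictScalars R :
        ⋀[S]^n (S ⊗[R] M) →ₗ[R] S ⊗[R] ⋀[R]^n M)

/-- `actExt τ = baseChangeEquiv ∘ (τ ⊗ id) ∘ baseChangeEquiv⁻¹` pointwise. -/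
theorem actExt_apply (τ : S ≃ₐ[R] S) (y : ⋀[S]^n (S ⊗[R] M)) :
    actExt b τ y =
      baseChangeEquiv R S M n b (coeffAct (⋀[R]^n M) τ ((baseChangeEquiv R S M n b).symm y)) :=
  rfl

/-- `actExt τ` on a wedge of the generators `1 ⊗ m_i`: it fixes them. -/
theorem actExt_ιMulti_one_tmul (τ : S ≃ₐ[R] S) (m : Fin n → M) :
    actExt b τ (exteriorPower.ιMulti S n (fun i => (1 : S) ⊗ₜ[R] m i)) =
      exteriorPower.ιMulti S n (fun i => (1 : S) ⊗ₜ[R] m i) := by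
  rw [actExt_apply, baseChangeEquiv_symm_ιMulti, coeffAct_tmul, map_one, baseChangeEquiv_apply,
    baseChangeMap_tmul_ιMulti, one_smul]

/-- `actExt τ` is `τ`-semilinear. -/
theorem actExt_smul (τ : S ≃ₐ[R] S) (s : S) (y : ⋀[S]^n (S ⊗[R] M)) :
    actExt b τ (s • y) = τ s • actExt b τ y := by
  simp only [actExt_apply, map_smul, coeffAct_smul]

/-- **`actExt τ` is «`⋀^n (τ ⊗ id)`»**: on every wedge `w₁ ∧ … ∧ wₙ` of elements of `S ⊗[R] M`
it is the wedge of the `(τ ⊗ id) w_i` — provided `S` is free over `R` with a basis `bS` (used only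
to reduce to basis vectors of `S ⊗[R] M`). -/
theorem actExt_ιMulti {J : Type*} (bS : Module.Basis J R S) (τ : S ≃ₐ[R] S)
    (w : Fin n → S ⊗[R] M) :
    actExt b τ (exteriorPower.ιMulti S n w) =
      exteriorPower.ιMulti S n (fun i => coeffAct M τ (w i)) := by
  -- both sides are `R`-alternating (in particular `R`-multilinear) in `w`; compare on the
  -- `R`-basis `bS j ⊗ b i` of `S ⊗[R] M`.
  let f : MultilinearMap R (fun _ : Fin n => S ⊗[R] M) (⋀[S]^n (S ⊗[R] M)) :=
    (actExt b τ).compMultilinearMap (ιMultiRestrict R S n (S ⊗[R] M)).toMultilinearMap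
  let g : MultilinearMap R (fun _ : Fin n => S ⊗[R] M) (⋀[S]^n (S ⊗[R] M)) :=
    ((ιMultiRestrict R S n (S ⊗[R] M)).toMultilinearMap).compLinearMap (fun _ => coeffAct M τ)
  have key : f = g := by
    apply Module.Basis.ext_multilinear (fun _ => bS.tensorProduct b)
    intro v
    simp only [f, g, LinearMap.compMultilinearMap_apply, MultilinearMap.compLinearMap_apply,
      AlternatingMap.coe_multilinearMap, ιMultiRestrict_apply, Module.Basis.tensorProduct_apply',
      coeffAct_tmul]
    -- `bS j ⊗ b i = bS j • (1 ⊗ b i)` and `τ (bS j) ⊗ b i = τ (bS j) • (1 ⊗ b i)`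
    have h1 : ∀ i, bS (v i).1 ⊗ₜ[R] b (v i).2 = bS (v i).1 • ((1 : S) ⊗ₜ[R] b (v i).2) := fun i => by
      rw [smul_tmul', smul_eq_mul, mul_one]
    have h2 : ∀ i, τ (bS (v i).1) ⊗ₜ[R] b (v i).2 = τ (bS (v i).1) • ((1 : S) ⊗ₜ[R] b (v i).2) :=
      fun i => by rw [smul_tmul', smul_eq_mul, mul_one]
    simp only [h1, h2, AlternatingMap.map_smul_univ, actExt_smul, actExt_ιMulti_one_tmul, map_prod]
  have := congrFun (congrArg DFunLike.coe key) w
  simpa [f, g] using this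

end Galois

end Summit.Ventures.HodgeRepro2.A1ExteriorBaseChange
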